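import Literature.NumberTheory.Sieve.TwistedCharacterSmoothSum
import Literature.NumberTheory.Sieve.GreenTao2008SharpGYDiagonal
import Mathlib.Analysis.SumIntegralComparisons
import Mathlib.Analysis.SpecialFunctions.Integrals.Basic
import HarnessLib

/-!
# GRH ⇒ Lindelöf for `L(s, χ; y)`: the unconditional lemmas

Topic `Literature/NumberTheory/LFunctions`. THEOREMS (everything proved). The elementary inputs
of `GRHSmoothEulerProduct.smoothLC_lindelof_of_grh` (`GRHSmoothEulerProductLindelof.lean`,
Lagarias–Soundararajan 2012, Prop. 5.1) that do not involve the Riemann hypothesis: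

* `norm_inv_one_sub_le_exp` — `‖(1 − z)⁻¹‖ ≤ exp(Re z + 12‖z‖²)` for `‖z‖ ≤ 3/4`, whence
  `norm_smoothLC_le_exp`: `‖L(s, χ; y)‖ ≤ exp(‖∑_{p ≤ y} χ(p)p^{-s}‖ + 12 ∑_{p ≤ y} p^{-2σ})`
  for `σ = Re s ≥ 1/2` (`L(s, χ; y) = Literature.NumberTheory.Sieve.TwistedWeight.smoothLC`);
* `sum_primesLE_rpow_le` — `∑_{p ≤ y} p^{-1-a} ≤ 1/a`;
* `norm_primeSum_sub_primitive_le`, `sum_primeFactors_rpow_le` — passage to the primitive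
  character costs `∑_{p ∣ q} p^{-1/2} ≤ δ log q + P_δ`.

## References

* J. C. Lagarias, K. Soundararajan, Proc. London Math. Soc. (3) 104 (2012), 770–798, §5.
  [LagariasSoundararajan2012]
* H. L. Montgomery, R. C. Vaughan, *Multiplicative Number Theory I*, CUP 2007, (12.12)–(12.13).
  [MontgomeryVaughan2007]
-/

noncomputable section

open Complex Filter Topology Set Finset
open scoped Real

namespace Literature.NumberTheory.LFunctions

namespace GRHSmoothEulerProduct

open DirichletCharacter
open Literature.NumberTheory.Sieve.TwistedWeight (smoothLC)

/-! ### The Euler factor -/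

/-- `‖(1 − z)⁻¹‖ ≤ exp(Re z + 12‖z‖²)` for `‖z‖ ≤ 3/4`
(`(1 − z)⁻¹ = 1 + z + z²/(1 − z)`, `|1 + z|² = 1 + 2 Re z + |z|² ≤ e^{2 Re z + |z|²}`,
`|z²/(1 − z)| ≤ 4|z|²`). [folklore] -/
theorem norm_inv_one_sub_le_exp {z : ℂ} (hz : ‖z‖ ≤ 3 / 4) :
    ‖(1 - z)⁻¹‖ ≤ Real.exp (z.re + 12 * ‖z‖ ^ 2) := by
  have hden : 1 / 4 ≤ ‖1 - z‖ := by
    have h := norm_sub_norm_le (1 : ℂ) z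
    rw [norm_one] at h
    linarith
  have h1z : 1 - z ≠ 0 := fun h ↦ by rw [h, norm_zero] at hden; norm_num at hden
  have hid : (1 - z)⁻¹ = (1 + z) + z ^ 2 / (1 - z) := by
    field_simp
    ring
  -- `‖z²/(1 − z)‖ ≤ 4‖z‖²`
  have h2 : ‖z ^ 2 / (1 - z)‖ ≤ 4 * ‖z‖ ^ 2 := by
    rw [norm_div, norm_pow, div_le_iff₀ (by linarith)]
    nlinarith [norm_nonneg z]
  -- `‖1 + z‖ ≤ exp(Re z + ‖z‖²/2)`
  set w : ℝ := z.re + ‖z‖ ^ 2 / 2 with hw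
  have h3 : ‖1 + z‖ ≤ Real.exp w := by
    have hsq : ‖1 + z‖ ^ 2 = 1 + 2 * z.re + ‖z‖ ^ 2 := by
      rw [Complex.sq_norm, Complex.sq_norm, Complex.normSq_apply, Complex.normSq_apply]
      simp; ring
    have hexp : ‖1 + z‖ ^ 2 ≤ Real.exp w ^ 2 := by
      rw [hsq, ← Real.exp_nat_mul]
      push_cast
      have := Real.add_one_le_exp (2 * w)
      rw [hw] at this ⊢
      linarith
    exact le_of_pow_le_pow_left₀ two_ne_zero (Real.exp_pos w).le hexp
  -- `exp(−w) ≤ e^{3/4} < 11/4`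
  have hre : -‖z‖ ≤ z.re := by
    have := Complex.abs_re_le_norm z; rw [abs_le] at this; exact this.1
  have hw34 : -(3 / 4) ≤ w := by rw [hw]; nlinarith [norm_nonneg z]
  have hexpw : Real.exp (-w) ≤ 11 / 4 := by
    calc Real.exp (-w) ≤ Real.exp 1 := Real.exp_le_exp.2 (by linarith)
      _ ≤ 11 / 4 := by linarith [Real.exp_one_lt_d9]
  have hE0 : 0 < Real.exp w := Real.exp_pos w
  calc ‖(1 - z)⁻¹‖ = ‖(1 + z) + z ^ 2 / (1 - z)‖ := by rw [hid]
    _ ≤ ‖1 + z‖ + ‖z ^ 2 / (1 - z)‖ := norm_add_le _ _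
    _ ≤ Real.exp w + 4 * ‖z‖ ^ 2 := add_le_add h3 h2
    _ = Real.exp w * (1 + Real.exp (-w) * (4 * ‖z‖ ^ 2)) := by
        rw [mul_add, mul_one, ← mul_assoc, ← Real.exp_add, add_neg_cancel, Real.exp_zero, one_mul]
    _ ≤ Real.exp w * (1 + 11 * ‖z‖ ^ 2) := by
        refine mul_le_mul_of_nonneg_left ?_ hE0.le
        nlinarith [norm_nonneg z, Real.exp_pos (-w)]
    _ ≤ Real.exp w * Real.exp (11 * ‖z‖ ^ 2) := by
        refine mul_le_mul_of_nonneg_left ?_ hE0.le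
        linarith [Real.add_one_le_exp (11 * ‖z‖ ^ 2)]
    _ = Real.exp (w + 11 * ‖z‖ ^ 2) := (Real.exp_add _ _).symm
    _ ≤ Real.exp (z.re + 12 * ‖z‖ ^ 2) := Real.exp_le_exp.2 (by rw [hw]; nlinarith [norm_nonneg z])

/-- `2^{-1/2} ≤ 3/4`, so `p^{-σ} ≤ 3/4` for `p ≥ 2`, `σ ≥ 1/2`. [folklore] -/
theorem rpow_neg_le_three_quarters {p : ℕ} (hp : 2 ≤ p) {σ : ℝ} (hσ : 1 / 2 ≤ σ) :
    (p : ℝ) ^ (-σ) ≤ 3 / 4 := by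
  have hp2 : (2 : ℝ) ≤ p := by exact_mod_cast hp
  calc (p : ℝ) ^ (-σ) ≤ (p : ℝ) ^ (-(1 / 2 : ℝ)) :=
        Real.rpow_le_rpow_of_exponent_le (by linarith) (by linarith)
    _ ≤ (2 : ℝ) ^ (-(1 / 2 : ℝ)) := Real.rpow_le_rpow_of_nonpos two_pos hp2 (by norm_num)
    _ = (Real.sqrt 2)⁻¹ := by rw [Real.rpow_neg zero_le_two, Real.sqrt_eq_rpow]
    _ ≤ 3 / 4 := by
        rw [inv_le_comm₀ (Real.sqrt_pos.2 two_pos) (by norm_num)]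
        rw [Real.le_sqrt (by norm_num) (by norm_num)]
        norm_num

/-- **The Euler product bound.** For `Re s ≥ 1/2` and any `χ` mod `q`,
`‖L(s, χ; y)‖ ≤ exp(‖∑_{p ≤ y} χ(p) p^{-s}‖ + 12 ∑_{p ≤ y} p^{-2 Re s})`. [folklore] -/
theorem norm_smoothLC_le_exp {q : ℕ} (χ : DirichletCharacter ℂ q) {s : ℂ} (hs : 1 / 2 ≤ s.re)
    (y : ℕ) :
    ‖smoothLC χ s y‖ ≤ Real.exp (‖∑ p ∈ Nat.primesLE y, χ (p : ZMod q) * (p : ℂ) ^ (-s)‖ +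
      12 * ∑ p ∈ Nat.primesLE y, (p : ℝ) ^ (-(2 * s.re))) := by
  rw [smoothLC, norm_prod]
  have hz : ∀ p ∈ Nat.primesLE y, ‖χ (p : ZMod q) * (p : ℂ) ^ (-s)‖ ≤ (p : ℝ) ^ (-s.re) := by
    intro p hp
    have hpp := (Nat.mem_primesLE.1 hp).2
    rw [norm_mul, Complex.norm_natCast_cpow_of_pos hpp.pos, neg_re]
    exact mul_le_of_le_one_left (Real.rpow_nonneg (Nat.cast_nonneg p) _) (χ.norm_le_one _)
  calc ∏ p ∈ Nat.primesLE y, ‖(1 - χ (p : ZMod q) * (p : ℂ) ^ (-s))⁻¹‖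
      ≤ ∏ p ∈ Nat.primesLE y, Real.exp ((χ (p : ZMod q) * (p : ℂ) ^ (-s)).re +
          12 * ‖χ (p : ZMod q) * (p : ℂ) ^ (-s)‖ ^ 2) := by
        refine Finset.prod_le_prod (fun p _ ↦ norm_nonneg _) fun p hp ↦ norm_inv_one_sub_le_exp ?_
        have hpp := (Nat.mem_primesLE.1 hp).2
        exact (hz p hp).trans (rpow_neg_le_three_quarters hpp.two_le hs)
    _ = Real.exp (∑ p ∈ Nat.primesLE y, ((χ (p : ZMod q) * (p : ℂ) ^ (-s)).re +
          12 * ‖χ (p : ZMod q) * (p : ℂ) ^ (-s)‖ ^ 2)) := (Real.exp_sum _ _).symm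
    _ ≤ _ := by
        refine Real.exp_le_exp.2 ?_
        rw [Finset.sum_add_distrib, ← Complex.re_sum, ← Finset.mul_sum]
        refine add_le_add (Complex.re_le_norm _) (mul_le_mul_of_nonneg_left ?_ (by norm_num))
        refine Finset.sum_le_sum fun p hp ↦ ?_
        have hpp := (Nat.mem_primesLE.1 hp).2
        have hp0 : (0 : ℝ) ≤ p := Nat.cast_nonneg p
        calc ‖χ (p : ZMod q) * (p : ℂ) ^ (-s)‖ ^ 2 ≤ ((p : ℝ) ^ (-s.re)) ^ 2 :=
              pow_le_pow_left₀ (norm_nonneg _) (hz p hp) 2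
          _ = (p : ℝ) ^ (-(2 * s.re)) := by
              rw [← Real.rpow_natCast, ← Real.rpow_mul hp0]; congr 1; push_cast; ring

/-! ### Elementary sums -/

/-- `∑_{p ≤ y} p^{-b} ≤ 1/a` whenever `b ≥ 1 + a`, `a > 0` (the primes are `≥ 2`, and
`∑_{n ≥ 2} n^{-1-a} ≤ 1/a`). [folklore] -/
theorem sum_primesLE_rpow_le {a b : ℝ} (ha : 0 < a) (hb : 1 + a ≤ b) (y : ℕ) :
    ∑ p ∈ Nat.primesLE y, (p : ℝ) ^ (-b) ≤ 1 / a := by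
  -- the tail `∑_{1 < n ≤ y} n^{-1-a} ≤ 1/a` (sum ≤ integral; in the tree in another form as
  -- `Literature.Probability.Process.sum_Ioc_rpow_neg_le`, not imported to keep the closure small)
  have htail : ∑ n ∈ Finset.Ioc 1 y, (n : ℝ) ^ (-1 - a) ≤ 1 / a := by
    rcases le_or_gt y 1 with h | h
    · rw [Finset.Ioc_eq_empty_of_le h, Finset.sum_empty]; positivity
    · have hNM : 1 ≤ y := h.le
      have e : ∑ n ∈ Finset.Ioc 1 y, (n : ℝ) ^ (-1 - a) =
          ∑ i ∈ Finset.Ico 1 y, ((i + 1 : ℕ) : ℝ) ^ (-1 - a) := by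
        rw [Finset.sum_Ico_add' (fun n : ℕ ↦ (n : ℝ) ^ (-1 - a)) 1 y 1, Finset.Ico_add_one_add_one_eq_Ioc]
      rw [e]
      have hanti : AntitoneOn (fun u : ℝ ↦ u ^ (-1 - a)) (Icc ((1 : ℕ) : ℝ) y) := fun u hu v _ huv ↦
        Real.rpow_le_rpow_of_nonpos (lt_of_lt_of_le (by norm_num) hu.1) huv (by linarith)
      refine (AntitoneOn.sum_le_integral_Ico hNM hanti).trans ?_
      have h0 : (0 : ℝ) ∉ Set.uIcc ((1 : ℕ) : ℝ) y := by
        rw [Set.uIcc_of_le (by exact_mod_cast hNM)]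
        exact fun h ↦ by have := h.1; norm_num at this
      rw [integral_rpow (Or.inr ⟨by linarith, h0⟩), show -1 - a + 1 = -a by ring, div_neg, neg_div',
        neg_sub]
      have h1 : 0 ≤ (y : ℝ) ^ (-a) := Real.rpow_nonneg (Nat.cast_nonneg y) _
      have h2 : ((1 : ℕ) : ℝ) ^ (-a) = 1 := by simp
      rw [h2]
      exact div_le_div_of_nonneg_right (by linarith) ha.le
  have hsub : Nat.primesLE y ⊆ Finset.Ioc 1 y := fun p hp ↦ by
    obtain ⟨hpy, hpp⟩ := Nat.mem_primesLE.1 hp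
    exact Finset.mem_Ioc.2 ⟨hpp.one_lt, hpy⟩
  calc ∑ p ∈ Nat.primesLE y, (p : ℝ) ^ (-b) ≤ ∑ n ∈ Finset.Ioc 1 y, (n : ℝ) ^ (-b) :=
        Finset.sum_le_sum_of_subset_of_nonneg hsub fun n _ _ ↦ Real.rpow_nonneg (Nat.cast_nonneg n) _
    _ ≤ ∑ n ∈ Finset.Ioc 1 y, (n : ℝ) ^ (-1 - a) := by
        refine Finset.sum_le_sum fun n hn ↦ ?_
        have hn1 : (1 : ℝ) ≤ n := by exact_mod_cast (Finset.mem_Ioc.1 hn).1.le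
        exact Real.rpow_le_rpow_of_exponent_le hn1 (by linarith)
    _ ≤ 1 / a := htail

/-- A sum of `≤ 1`-bounded terms over the primes `≤ N` is at most `N + 1` in norm:
`‖∑_{p ≤ N} χ(p) p^{-s}‖ ≤ N + 1` for `Re s ≥ 0`. [folklore] -/
theorem norm_sum_primes_le_card {q : ℕ} (χ : DirichletCharacter ℂ q) {s : ℂ} (hs : 0 ≤ s.re) (N : ℕ) :
    ‖∑ p ∈ (Finset.Icc 0 N).filter Nat.Prime, χ (p : ZMod q) * (p : ℂ) ^ (-s)‖ ≤ N + 1 := by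
  calc _ ≤ ∑ p ∈ (Finset.Icc 0 N).filter Nat.Prime, ‖χ (p : ZMod q) * (p : ℂ) ^ (-s)‖ := norm_sum_le _ _
    _ ≤ ∑ p ∈ (Finset.Icc 0 N).filter Nat.Prime, (1 : ℝ) := by
        refine Finset.sum_le_sum fun p hp ↦ ?_
        have hpp := (Finset.mem_filter.1 hp).2
        rw [norm_mul, Complex.norm_natCast_cpow_of_pos hpp.pos, neg_re]
        have h1 : (p : ℝ) ^ (-s.re) ≤ 1 :=
          Real.rpow_le_one_of_one_le_of_nonpos (by exact_mod_cast hpp.one_lt.le) (by linarith)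
        exact mul_le_one₀ (χ.norm_le_one _) (Real.rpow_nonneg (Nat.cast_nonneg p) _) h1
    _ = ((Finset.Icc 0 N).filter Nat.Prime).card := by simp
    _ ≤ N + 1 := by
        have := (Finset.card_filter_le (Finset.Icc 0 N) Nat.Prime).trans (Nat.card_Icc 0 N).le
        exact_mod_cast (by omega : ((Finset.Icc 0 N).filter Nat.Prime).card ≤ N + 1)

/-! ### The imprimitive character -/

/-- Passing to the primitive character: for `χ` mod `q`, `χ⋆ = χ.primitiveCharacter`, a finite
set `S` of primes and `Re s ≥ 1/2`,
`‖∑_{p ∈ S} χ(p) p^{-s} − ∑_{p ∈ S} χ⋆(p) p^{-s}‖ ≤ ∑_{p ∣ q} p^{-1/2}` (the two sums differ only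
at the primes dividing `q`). [cite: MontgomeryVaughan2007, (12.12)–(12.13)] -/
theorem norm_primeSum_sub_primitive_le {q : ℕ} [NeZero q] (χ : DirichletCharacter ℂ q) {s : ℂ}
    (hs : 1 / 2 ≤ s.re) {S : Finset ℕ} (hS : ∀ p ∈ S, p.Prime) :
    ‖∑ p ∈ S, χ (p : ZMod q) * (p : ℂ) ^ (-s) -
        ∑ p ∈ S, χ.primitiveCharacter (p : ZMod χ.conductor) * (p : ℂ) ^ (-s)‖ ≤
      ∑ p ∈ q.primeFactors, (p : ℝ) ^ (-(1 / 2 : ℝ)) := by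
  classical
  have h1 : ∑ p ∈ S, χ (p : ZMod q) * (p : ℂ) ^ (-s) =
      ∑ p ∈ S.filter (fun p ↦ p.Coprime q), χ.primitiveCharacter (p : ZMod χ.conductor) * (p : ℂ) ^ (-s) := by
    rw [← Finset.sum_filter_add_sum_filter_not S (fun p ↦ p.Coprime q)]
    have hz : ∑ p ∈ S.filter (fun p ↦ ¬p.Coprime q), χ (p : ZMod q) * (p : ℂ) ^ (-s) = 0 := by
      refine Finset.sum_eq_zero fun p hp ↦ ?_
      have hnc : ¬p.Coprime q := (Finset.mem_filter.mp hp).2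
      rw [MulChar.map_nonunit χ (mt (ZMod.isUnit_iff_coprime p q).mp hnc), zero_mul]
    rw [hz, add_zero]
    refine Finset.sum_congr rfl fun p hp ↦ ?_
    have hc : p.Coprime q := (Finset.mem_filter.mp hp).2
    have := χ.primitiveCharacter_apply_of_isCoprime (Nat.isCoprime_iff_coprime.mpr hc)
    push_cast at this
    rw [this]
  have h2 : ∑ p ∈ S, χ.primitiveCharacter (p : ZMod χ.conductor) * (p : ℂ) ^ (-s) =
      ∑ p ∈ S.filter (fun p ↦ p.Coprime q), χ.primitiveCharacter (p : ZMod χ.conductor) * (p : ℂ) ^ (-s) +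
        ∑ p ∈ S.filter (fun p ↦ ¬p.Coprime q),
          χ.primitiveCharacter (p : ZMod χ.conductor) * (p : ℂ) ^ (-s) := by
    rw [Finset.sum_filter_add_sum_filter_not]
  rw [h1, h2, sub_add_cancel_left, norm_neg]
  have hsub : S.filter (fun p ↦ ¬p.Coprime q) ⊆ q.primeFactors := by
    intro p hp
    obtain ⟨hpS, hnc⟩ := Finset.mem_filter.mp hp
    have hpp : p.Prime := hS p hpS
    have hpq : p ∣ q := by
      by_contra h
      exact hnc ((Nat.Prime.coprime_iff_not_dvd hpp).mpr h)
    exact Nat.mem_primeFactors.2 ⟨hpp, hpq, NeZero.ne q⟩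
  calc ‖∑ p ∈ S.filter (fun p ↦ ¬p.Coprime q), χ.primitiveCharacter (p : ZMod χ.conductor) * (p : ℂ) ^ (-s)‖
      ≤ ∑ p ∈ S.filter (fun p ↦ ¬p.Coprime q),
          ‖χ.primitiveCharacter (p : ZMod χ.conductor) * (p : ℂ) ^ (-s)‖ := norm_sum_le _ _
    _ ≤ ∑ p ∈ S.filter (fun p ↦ ¬p.Coprime q), (p : ℝ) ^ (-(1 / 2 : ℝ)) := by
        refine Finset.sum_le_sum fun p hp ↦ ?_
        have hpp : p.Prime := hS p (Finset.mem_filter.mp hp).1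
        rw [norm_mul, Complex.norm_natCast_cpow_of_pos hpp.pos, neg_re]
        calc _ ≤ 1 * (p : ℝ) ^ (-s.re) :=
              mul_le_mul_of_nonneg_right (DirichletCharacter.norm_le_one _ _) (Real.rpow_nonneg (Nat.cast_nonneg p) _)
          _ ≤ (p : ℝ) ^ (-(1 / 2 : ℝ)) := by
              rw [one_mul]
              exact Real.rpow_le_rpow_of_exponent_le (by exact_mod_cast hpp.one_lt.le) (by linarith)
    _ ≤ ∑ p ∈ q.primeFactors, (p : ℝ) ^ (-(1 / 2 : ℝ)) :=
        Finset.sum_le_sum_of_subset_of_nonneg hsub fun p _ _ ↦ Real.rpow_nonneg (Nat.cast_nonneg p) _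

/-- The imprimitive factor is `≪_δ q^δ`, logarithmically: for every `δ > 0` there is `P_δ` with
`∑_{p ∣ q} p^{-1/2} ≤ δ log q + P_δ` for all `q ≠ 0` (primes `≤ P₀ ≈ (δ log 2)^{-2}` contribute
`≤ P₀ + 1`, the others `≤ ω(q) P₀^{-1/2} ≤ (log q/log 2) δ log 2`). [folklore] -/
theorem sum_primeFactors_rpow_le {δ : ℝ} (hδ : 0 < δ) :
    ∃ P : ℝ, 0 ≤ P ∧ ∀ q : ℕ, q ≠ 0 →
      ∑ p ∈ q.primeFactors, (p : ℝ) ^ (-(1 / 2 : ℝ)) ≤ δ * Real.log q + P := by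
  classical
  have hlog2 : 0 < Real.log 2 := Real.log_pos one_lt_two
  -- `P₀` with `P₀^{-1/2} ≤ δ log 2`
  obtain ⟨P₀, hP₀1, hkey⟩ : ∃ P₀ : ℕ, 1 ≤ P₀ ∧ (P₀ : ℝ) ^ (-(1 / 2 : ℝ)) ≤ δ * Real.log 2 := by
    set a := δ * Real.log 2 with ha
    have ha0 : 0 < a := by positivity
    refine ⟨⌈(1 / a) ^ 2⌉₊ + 1, by omega, ?_⟩
    set P₀ : ℕ := ⌈(1 / a) ^ 2⌉₊ + 1 with hP₀
    have hP : (1 / a) ^ 2 ≤ (P₀ : ℝ) := by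
      rw [hP₀]; push_cast; linarith [Nat.le_ceil ((1 / a) ^ 2)]
    have hP0 : (0 : ℝ) < P₀ := by rw [hP₀]; positivity
    have hsqrt : 1 / a ≤ Real.sqrt P₀ := by
      rw [Real.le_sqrt (by positivity) hP0.le]; exact hP
    rw [Real.rpow_neg hP0.le, ← Real.sqrt_eq_rpow]
    calc (Real.sqrt P₀)⁻¹ ≤ (1 / a)⁻¹ := inv_anti₀ (by positivity) hsqrt
      _ = a := by rw [one_div, inv_inv]
  refine ⟨(P₀ : ℝ) + 1, by positivity, fun q hq ↦ ?_⟩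
  set S := q.primeFactors with hS
  rw [← Finset.sum_filter_add_sum_filter_not S (fun p ↦ p ≤ P₀)]
  have h1 : ∑ p ∈ S.filter (fun p ↦ p ≤ P₀), (p : ℝ) ^ (-(1 / 2 : ℝ)) ≤ P₀ + 1 := by
    calc ∑ p ∈ S.filter (fun p ↦ p ≤ P₀), (p : ℝ) ^ (-(1 / 2 : ℝ))
        ≤ ∑ p ∈ S.filter (fun p ↦ p ≤ P₀), (1 : ℝ) := by
          refine Finset.sum_le_sum fun p hp ↦ ?_
          have hpp := Nat.prime_of_mem_primeFactors (Finset.mem_filter.1 hp).1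
          exact Real.rpow_le_one_of_one_le_of_nonpos (by exact_mod_cast hpp.one_lt.le) (by norm_num)
      _ = ((S.filter (fun p ↦ p ≤ P₀)).card : ℝ) := by simp
      _ ≤ P₀ + 1 := by
          have hsub : S.filter (fun p ↦ p ≤ P₀) ⊆ Finset.range (P₀ + 1) := fun p hp ↦
            Finset.mem_range.2 (Nat.lt_succ_of_le (Finset.mem_filter.1 hp).2)
          have := (Finset.card_le_card hsub).trans (Finset.card_range (P₀ + 1)).le
          exact_mod_cast this
  have h2 : ∑ p ∈ S.filter (fun p ↦ ¬p ≤ P₀), (p : ℝ) ^ (-(1 / 2 : ℝ)) ≤ δ * Real.log q := by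
    have hP0r : (0 : ℝ) < P₀ := by exact_mod_cast hP₀1
    calc ∑ p ∈ S.filter (fun p ↦ ¬p ≤ P₀), (p : ℝ) ^ (-(1 / 2 : ℝ))
        ≤ ∑ p ∈ S.filter (fun p ↦ ¬p ≤ P₀), (P₀ : ℝ) ^ (-(1 / 2 : ℝ)) := by
          refine Finset.sum_le_sum fun p hp ↦ ?_
          exact Real.rpow_le_rpow_of_nonpos hP0r
            (by exact_mod_cast (not_le.1 (Finset.mem_filter.1 hp).2).le) (by norm_num)
      _ = ((S.filter (fun p ↦ ¬p ≤ P₀)).card : ℝ) * (P₀ : ℝ) ^ (-(1 / 2 : ℝ)) := by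
          rw [Finset.sum_const, nsmul_eq_mul]
      _ ≤ (S.card : ℝ) * (P₀ : ℝ) ^ (-(1 / 2 : ℝ)) :=
          mul_le_mul_of_nonneg_right (by exact_mod_cast Finset.card_filter_le _ _)
            (Real.rpow_nonneg hP0r.le _)
      _ ≤ (S.card : ℝ) * (δ * Real.log 2) := mul_le_mul_of_nonneg_left hkey (Nat.cast_nonneg _)
      _ = δ * ((S.card : ℝ) * Real.log 2) := by ring
      _ ≤ δ * Real.log q :=
          mul_le_mul_of_nonneg_left
            (Literature.NumberTheory.Sieve.GreenTao2008.SharpGY.card_primeFactors_mul_log_two_le hq) hδ.le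
  linarith

end GRHSmoothEulerProduct

end Literature.NumberTheory.LFunctions
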